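import Mathlib
import Summits.PneNP.PneNP.Theorems.CnfIdealGenLengthRankDefectRepresentationsMergeReduction
import Summits.PneNP.PneNP.Theorems.CnfIdealGenLengthRankDefectRepresentationsCutLemmaMaxCut

/-!
# Crux `RankDefectRepresentations` (stmt-PneNP-18923), line `rank-dehn-ladder`: MERGE and ADJACENT SPLITTING from the constant-4 decomposition
# (lead g16, RESHAPE 16; memo `Cruxes/RankDefectRepresentations/Lines/rank-dehn-ladder-g16.md` §7)

Given the two-family max-cut decomposition with the absolute constant 4 (`DoubleMaxCutDecomposition K n n' 4` for all `K, n, n'` —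
`…DoubleMaxCutFour.doubleMaxCut_four` from the registered stubs X1/X2; taken here as the hypothesis `h4`), the two registered lead stubs of
`Lines/rank_dehn_ladder.lean` follow at once:
* `merge_of_four` — the registered `stub_merge` statement with `L₁ = 4`, `e = 0` (`…MergeReduction.merge_of_doubleMaxCut`);
* `adjacentSplitting_of_four` — the registered `stub_adjacentSplitting` statement with `C₀ = 8`, `e = 0`, `c₀ = c₁ = 0`: with `D = S_I + S_J + L`,
  `rank L ≤ 4c`, take `G := L ∘ 1[last bits agree]` (rank `≤ 8c`); then `D − G = S_I + S_J` on every non-cross cell, so both halves of `D − G` have ALL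
  double cuts equal to `0`.
HONEST FRAMING: negative-lane tools; the item (RDR) stays open; P ≠ NP is not moved; F-N2 is a FRONTIER formal rung.
-/

set_option linter.dupNamespace false -- `Summit.PneNP.PneNP.…`: summit = sub-problem name (D-0017)

namespace Summit.PneNP.PneNP.Theorems.CnfIdealGenLengthRankDefectRepresentationsCloseFour

open Matrix Finset
open Summit.PneNP.PneNP.Theorems.CnfIdealGenLengthRankDefectRepresentationsMergeLowerBound (rank_add_le')
open Summit.PneNP.PneNP.Theorems.CnfIdealGenLengthRankDefectRepresentationsTwoFamilyCutDomination (colourI colourJ maskJ doubleCut DoubleMaxCutDecomposition)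
open Summit.PneNP.PneNP.Theorems.CnfIdealGenLengthRankDefectRepresentationsMergeReduction (MergeBound merge_of_doubleMaxCut rowHalf colHalf lastR lastC)
open Summit.PneNP.PneNP.Theorems.CnfIdealGenLengthRankDefectRepresentationsCutLemmaMaxCut (rank_rowZero_le rank_colZero_le)

variable {K : Type} [Field K]

/-- **MERGE with the absolute constant 4** (the registered `stub_merge`'s statement, `L₁ = 4`, `e = 0`), from the constant-4 decomposition. -/
theorem merge_of_four (h4 : ∀ (K : Type) [Field K] (n n' : ℕ), DoubleMaxCutDecomposition K n n' 4) :
    ∃ L₁ e : ℕ, ∀ (K : Type) [Field K] (n n' : ℕ), MergeBound K n n' (L₁ * (n + n' + 2) ^ e) := by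
  refine ⟨4, 0, fun K _ n n' => ?_⟩
  simpa using merge_of_doubleMaxCut (h4 K n (n' + 1))

/-- **ADJACENT SPLITTING with the absolute constant 8** (the registered `stub_adjacentSplitting`'s statement, `C₀ = 8`, `e = 0`, budgets `0 + 0 ≤ c`),
from the constant-4 decomposition: `G := L ∘ 1[last bits agree]`. -/
theorem adjacentSplitting_of_four (h4 : ∀ (K : Type) [Field K] (n n' : ℕ), DoubleMaxCutDecomposition K n n' 4) :
    ∃ C₀ e : ℕ, ∀ (K : Type) [Field K] (n n' : ℕ),
      (∀ (ι ι' : Type) [Fintype ι] [Fintype ι'] [DecidableEq ι] [DecidableEq ι']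
          (row : ι → Fin n ⊕ Fin (n' + 1) → Bool) (col : ι' → Fin n ⊕ Fin (n' + 1) → Bool) (D : Matrix ι ι' K) (c : ℕ),
          (∀ B B', doubleCut row col B B' D ≤ c) →
          ∃ G : Matrix ι ι' K,
            (∀ x y, row x (Sum.inr (Fin.last n')) ≠ col y (Sum.inr (Fin.last n')) → G x y = 0) ∧
            G.rank ≤ (C₀ * (n + n' + 2) ^ e) * c ∧
            ∃ c₀ c₁ : ℕ, c₀ + c₁ ≤ c ∧
              (∀ B B', doubleCut (rowHalf row false) (colHalf col false) B B' ((D - G).submatrix Subtype.val Subtype.val) ≤ c₀) ∧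
              (∀ B B', doubleCut (rowHalf row true) (colHalf col true) B B' ((D - G).submatrix Subtype.val Subtype.val) ≤ c₁)) := by
  refine ⟨8, 0, fun K _ n n' => ?_⟩
  intro ι ι' _ _ _ _ row col D c hc
  classical
  obtain ⟨SI, SJ, hSI, hSJ, hL⟩ := h4 K n (n' + 1) ι ι' row col D c hc
  set L : Matrix ι ι' K := D - SI - SJ with hLdef
  set G : Matrix ι ι' K := Matrix.of fun x y =>
    if row x (Sum.inr (Fin.last n')) = col y (Sum.inr (Fin.last n')) then L x y else 0 with hG
  refine ⟨G, fun x y hne => by simp [hG, hne], ?_, 0, 0, by simp, ?_, ?_⟩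
  · -- rank G ≤ 8c: G is the sum of the two diagonal last-bit blocks of L
    have e : G = (Matrix.of fun x y => if row x (Sum.inr (Fin.last n')) = false then
          (Matrix.of fun x y => if col y (Sum.inr (Fin.last n')) = false then L x y else (0 : K)) x y else 0) +
        (Matrix.of fun x y => if row x (Sum.inr (Fin.last n')) = true then
          (Matrix.of fun x y => if col y (Sum.inr (Fin.last n')) = true then L x y else (0 : K)) x y else 0) := by
      ext x y
      simp only [hG, Matrix.of_apply, Matrix.add_apply]
      rcases Bool.eq_false_or_eq_true (row x (Sum.inr (Fin.last n'))) with h1 | h1 <;>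
        rcases Bool.eq_false_or_eq_true (col y (Sum.inr (Fin.last n'))) with h2 | h2 <;> simp [h1, h2]
    have r1 := (rank_rowZero_le (fun x => row x (Sum.inr (Fin.last n')) = false)
      (Matrix.of fun x y => if col y (Sum.inr (Fin.last n')) = false then L x y else (0 : K))).trans
      (rank_colZero_le (fun y => col y (Sum.inr (Fin.last n')) = false) L)
    have r2 := (rank_rowZero_le (fun x => row x (Sum.inr (Fin.last n')) = true)
      (Matrix.of fun x y => if col y (Sum.inr (Fin.last n')) = true then L x y else (0 : K))).trans
      (rank_colZero_le (fun y => col y (Sum.inr (Fin.last n')) = true) L)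
    rw [e]
    refine (rank_add_le' _ _).trans ?_
    have : L.rank ≤ 4 * c := hL
    simp only [pow_zero, mul_one]
    omega
  all_goals
    intro B B'
    apply le_of_eq
    -- every visible cell of the half instance of `D - G` vanishes
    have key : ∀ (b : Bool) (x : {x : ι // lastR row x = b}) (y : {y : ι' // lastC col y = b}),
        colourI (rowHalf row b x) ≠ colourI (colHalf col b y) → colourJ (rowHalf row b x) ≠ colourJ (colHalf col b y) →
        ((D - G).submatrix Subtype.val Subtype.val) x y = 0 := by
      intro b x y hI hJ
      have hx : row x.1 (Sum.inr (Fin.last n')) = b := x.2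
      have hy : col y.1 (Sum.inr (Fin.last n')) = b := y.2
      have hGxy : G x.1 y.1 = L x.1 y.1 := by simp [hG, hx, hy]
      have h1 : SI x.1 y.1 = 0 := by
        apply hSI
        by_contra hcon
        push Not at hcon
        apply hI
        funext k
        exact hcon k
      have h2 : SJ x.1 y.1 = 0 := by
        apply hSJ
        by_contra hcon
        push Not at hcon
        apply hJ
        funext k'
        exact hcon (Fin.castSucc k')
      simp only [Matrix.submatrix_apply, Matrix.sub_apply, hGxy, hLdef, h1, h2]
      ring
    unfold doubleCut
    have z1 : ∀ (b : Bool),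
        (Matrix.of fun (x : {x : ι // lastR row x = b}) (y : {y : ι' // lastC col y = b}) =>
          if colourI (rowHalf row b x) ∈ B ∧ colourI (colHalf col b y) ∉ B then
            maskJ (rowHalf row b) (colHalf col b) B' ((D - G).submatrix Subtype.val Subtype.val) x y else 0) = 0 := by
      intro b; ext x y
      simp only [Matrix.of_apply, Matrix.zero_apply, maskJ]
      split_ifs with h1 h2
      · exact key b x y (fun h => h1.2 (h ▸ h1.1)) (fun h => h2 (by rw [h]))
      · rfl
      · rfl
    have z2 : ∀ (b : Bool),
        (Matrix.of fun (x : {x : ι // lastR row x = b}) (y : {y : ι' // lastC col y = b}) =>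
          if colourI (rowHalf row b x) ∉ B ∧ colourI (colHalf col b y) ∈ B then
            maskJ (rowHalf row b) (colHalf col b) B' ((D - G).submatrix Subtype.val Subtype.val) x y else 0) = 0 := by
      intro b; ext x y
      simp only [Matrix.of_apply, Matrix.zero_apply, maskJ]
      split_ifs with h1 h2
      · exact key b x y (fun h => h1.1 (h ▸ h1.2)) (fun h => h2 (by rw [h]))
      · rfl
      · rfl
    rw [z1, z2, Matrix.rank_zero]

end Summit.PneNP.PneNP.Theorems.CnfIdealGenLengthRankDefectRepresentationsCloseFour
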